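import Mathlib.Data.List.Basic

/-!
# Cuspidal descent — kernel certificate of Lemma Φ and of the WINDOW-2 lemma in the finite model

Crux `EllipticUnitValueSevenOfGZK` (stmt-BirchSwinnertonDyer-19945), crux idea
`cuspidal-descent-kolyvagin-nonvanishing`, memos `CuspidalDescentHoward-g39.md` (§§6–7, Appendix C)
and `CuspidalDescentWindow-g42.md` (THEOREM W).

This file is a faithful Lean port of the finite abstraction of g39 Appendix C (the Python script
`CuspidalDescentHoward-g39-modelcheck.md`): a configuration records the active system, the class sign,
whether the active socle is thin, and the dimensions / thin-dimensions of the four eigen-spaces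
`E^±(n), E′^±(n)`; one Kolyvagin-prime step of type `t` moves every space by `±1` subject to the
proved constraints C.0/C.1 of g39 (3.2, 3.3, 3.6(d), 4.1 exactness, 4.2, 4.4, 6.0, the sign-wise index
increment of Appendix B), with GREEDY passive cutting and an adversary choosing everything else.

What is certified here (by `native_decide`, i.e. modulo `Lean.ofReduceBool`; no `sorry`):

* `phiR1_le4`, `phiR1_le5` : at every valid configuration with all four dimensions `≤ 4` (resp. `≤ 5`),
  every step whose type is forced or is the R1 type `t(Y, ε)` has `Δ(ρ_E + ρ_E′) ≤ 0` (Lemma Φ, g39 7.2),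
  and a step with `Δ(ρ_E + ρ_E′) > 0` is a free ii′-step of the anti-R1 type (Lemma P of g42).
* `window2_le4`, `window2_le5` : POLICY-FREE WINDOW 2 — at every valid configuration (dims `≤ 4`, resp. `≤ 5`),
  for EVERY admissible type, every `Ψ`-neutral non-leaf child is, after the forced transfers, in Case i′,
  and EVERY admissible continuation from it has `Δ(ρ_E + ρ_E′) < 0`.  No rule R2 is used anywhere.

The human-readable proof of the same statements for ALL dimensions is THEOREM W of memo g42; this file
certifies the case analysis in the range where every sub-case of that proof occurs.
No summit statement is proved by this file.
-/

set_option linter.dupNamespace false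

namespace Summit.BirchSwinnertonDyer.BirchSwinnertonDyer.Cruxes.EllipticUnitValueSevenOfGZK.CuspidalDescent.Window

/-- Systems: `false = E`, `true = E′`.  Signs: `false = +`, `true = −`.  Types: `false = A`, `true = B`.
Visibility table 3.3 of g39: `t(E,+) = t(E′,−) = A`, `t(E,−) = t(E′,+) = B`. -/
def vis (Z d : Bool) : Bool := xor Z d

/-- A configuration of the joint recursion (g39 Appendix C.0). -/
structure St where
  a : Bool                 -- active system
  e : Bool                 -- class sign at the node
  dthin : Bool             -- is the active socle `d_X(n)` thin?
  n : Bool → Bool → Nat    -- `n Z δ = dim Z^δ(n)`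
  th : Bool → Bool → Nat   -- thin dimensions

inductive Case | i | ii | hyp
  deriving DecidableEq, Repr

def rho (s : St) (Z : Bool) : Nat := s.n Z false + s.n Z true

def allthin (s : St) (Z : Bool) : Bool :=
  (s.th Z false == s.n Z false) && (s.th Z true == s.n Z true)

/-- Standing constraints C.0 (all proved in g39): `th ≤ n`; 6.0 parity; active node non-trivial;
4.1 exactness (full quotient of one side injects into the thin part of the other, sign-wise);
socles with exactly-one-thin (4.2); 4.4 consequences of `B⁺`. -/
def valid (s : St) : Bool :=
  let a := s.a
  let y := !s.a
  let e := s.e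
  (decide (s.th false false ≤ s.n false false)) && (decide (s.th false true ≤ s.n false true)) &&
  (decide (s.th true false ≤ s.n true false)) && (decide (s.th true true ≤ s.n true true)) &&
  -- 6.0: class-sign spaces odd, companions even (both systems)
  (s.n false e % 2 == 1) && (s.n false (!e) % 2 == 0) &&
  (s.n true e % 2 == 1) && (s.n true (!e) % 2 == 0) &&
  -- active node non-trivial
  (decide (3 ≤ s.n a false + s.n a true)) &&
  -- 4.1 exactness, sign-wise
  (decide (s.n true false ≤ s.th false false + s.th true false)) &&
  (decide (s.n true true ≤ s.th false true + s.th true true)) &&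
  (decide (s.n false false ≤ s.th true false + s.th false false)) &&
  (decide (s.n false true ≤ s.th true true + s.th false true)) &&
  -- socles: `d_X ∈ X^e`, `s_Y ∈ Y^e`, exactly one thin (4.2)
  (decide (1 ≤ s.n a e)) && (decide (1 ≤ s.n y e)) &&
  (if s.dthin then (decide (1 ≤ s.th a e)) && (decide (s.th y e < s.n y e))
   else (decide (s.th a e < s.n a e)) && (decide (1 ≤ s.th y e))) &&
  -- 4.4: all-thin(E) ⇒ ρ′ ≥ ρ + 2 ; all-thin(E′) ⇒ ρ ≥ ρ′
  (!(allthin s false) || decide (rho s false + 2 ≤ rho s true)) &&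
  (!(allthin s true) || decide (rho s true ≤ rho s false))

/-- Trichotomy 6.2 of g39 for the active system: `none` = `B⁺` (transfer), else the case and the
admissible types. -/
def classify (s : St) : Option (Case × List Bool) :=
  let a := s.a
  let e := s.e
  let comp := s.n a (!e)
  let compth := s.th a (!e)
  if allthin s a && decide (1 ≤ comp) then none
  else
    let good := (!s.dthin) || (comp == 0) || decide (compth < comp)
    if good then
      if comp == 0 then some (Case.ii, if s.dthin then [vis a e] else [false, true])
      else if s.dthin then some (Case.i, [vis a e])
      else some (Case.i, if decide (compth < comp) then [false, true] else [vis a (!e)])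
    else if decide (s.th a e < s.n a e) then some (Case.hyp, [vis a e])
    else none

/-- 4.5: transfer of the claim to the other system; the new active socle is full (4.2). -/
def transfer (s : St) : St := { s with a := !s.a, dthin := false }

/-- Apply transfers until the active system is GOOD or HYP (at most two; 4.4(iii)). -/
def normalize (s : St) : Option (St × Case × List Bool) :=
  match classify s with
  | some r => some (s, r)
  | none =>
    let s1 := transfer s
    if !(valid s1) then none else
    match classify s1 with
    | some r => some (s1, r)
    | none =>
      let s2 := transfer s1
      if !(valid s2) then none else
      match classify s2 with
      | some r => some (s2, r)
      | none => none

/-- An adversary option for one space: `cut c₁` (dimension `−1`, thin dimension `−c₁`) or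
`uncut ν` (dimension `+1`, thin dimension `+ν`). -/
inductive Opt | cut (c1 : Bool) | uncut (nu : Bool)
  deriving DecidableEq, Repr

def upd (f : Bool → Bool → Nat) (Z d : Bool) (v : Nat) : Bool → Bool → Nat :=
  fun Z' d' => if (Z' == Z) && (d' == d) then v else f Z' d'
def updI (f : Bool → Bool → Int) (Z d : Bool) (v : Int) : Bool → Bool → Int :=
  fun Z' d' => if (Z' == Z) && (d' == d) then v else f Z' d'

/-- The options of space `(Z, d)` at a step of type `t` given the demanded cut pattern (C.1, C.2). -/
def optsOf (s : St) (t : Bool) (Z d : Bool) (cut : Bool) (forced : Option Bool) : List Opt :=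
  if cut then
    if vis Z d == t then
      let cands : List Bool :=
        if s.th Z d == 0 then [false] else if s.n Z d == s.th Z d then [true] else [false, true]
      let cands := match forced with
        | none => cands
        | some f => cands.filter (fun c => c == f)
      cands.map Opt.cut
    else [Opt.cut false]
  else [Opt.uncut false, Opt.uncut true]

/-- One prime step of type `t` at a GOOD/HYP node: all adversary-consistent children, each with
`Δ(ρ_E + ρ_E′)`; a child `none` is a LEAF (`ρ_X(child) < 3`, i.e. `M_X = 0`).  Demands (C.2):
`X^ε` cut through `d_X`; i′: companion cut; ii′/HYP: companion uncut (HYP: `c₊` survives);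
passive `Y^ε` cut iff `s_Y` is `t`-visible (3.6(d)) or `Y^ε` has a full class (greedy);
passive `Y^{−ε}` cut iff it has a `t`-visible class (greedy). -/
def steps (s : St) (t : Bool) (cs : Case) : List (Option St × Int) :=
  let a := s.a
  let y := !s.a
  let e := s.e
  let ne := !s.e
  -- active class space
  let cutAe := true
  let fAe : Option Bool := if s.dthin then some true else none
  -- active companion
  let cutAc := match cs with | Case.i => true | _ => false
  let fAc : Option Bool :=
    match cs with
    | Case.i => if s.n a ne == s.th a ne then some true else none
    | _ => none
  -- passive class space (contains s_Y; s_Y thin iff ¬ dthin)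
  let dYvis := s.dthin || (vis y e == t)
  let cutPe := if dYvis then true else decide (s.th y e < s.n y e)
  let fPe : Option Bool := if dYvis then (if !s.dthin then some true else none)
                           else (if decide (s.th y e < s.n y e) then some false else none)
  -- passive companion
  let hasvis := decide (s.th y ne < s.n y ne) || (decide (1 ≤ s.th y ne) && (vis y ne == t))
  let cutPc := hasvis
  let o1 := optsOf s t a e cutAe fAe
  let o2 := optsOf s t a ne cutAc fAc
  let o3 := optsOf s t y e cutPe fPe
  let o4 := optsOf s t y ne cutPc none
  let combos : List (Opt × Opt × Opt × Opt) :=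
    o1.flatMap fun x1 => o2.flatMap fun x2 => o3.flatMap fun x3 => o4.map fun x4 => (x1, x2, x3, x4)
  combos.flatMap fun ⟨x1, x2, x3, x4⟩ =>
    -- apply the four options
    let app := fun (acc : (Bool → Bool → Nat) × (Bool → Bool → Nat) × (Bool → Bool → Int))
                   (Z d : Bool) (o : Opt) =>
      let (n2, th2, dth) := acc
      match o with
      | Opt.cut c1 => (upd n2 Z d (s.n Z d - 1), upd th2 Z d (s.th Z d - (if c1 then 1 else 0)),
                       updI dth Z d (if c1 then -1 else 0))
      | Opt.uncut nu => (upd n2 Z d (s.n Z d + 1), upd th2 Z d (s.th Z d + (if nu then 1 else 0)),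
                         updI dth Z d (if nu then 1 else 0))
    let acc0 : (Bool → Bool → Nat) × (Bool → Bool → Nat) × (Bool → Bool → Int) :=
      (s.n, s.th, fun _ _ => 0)
    let acc := app (app (app (app acc0 a e x1) a ne x2) y e x3) y ne x4
    let (n2, th2, dth) := acc
    -- sign-wise index increment (Appendix B): dark minus visible thin dimension increases by exactly 1
    let okIdx := [false, true].all fun d =>
      let Zv := if vis false d == t then false else true
      let Zd := !Zv
      dth Zd d - dth Zv d == 1
    if !okIdx then [] else
    -- HYP: the spared full class survives in the child companion
    if (match cs with | Case.hyp => !(decide (th2 a e < n2 a e)) | _ => false) then [] else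
    let drho : Int := ((n2 false false + n2 false true + n2 true false + n2 true true : Nat) : Int)
                      - ((s.n false false + s.n false true + s.n true false + s.n true true : Nat) : Int)
    -- both child class-sign spaces are non-zero (Kolyvagin relation)
    if (n2 a ne == 0) || (n2 y ne == 0) then [] else
    if decide (n2 a false + n2 a true < 3) then [(none, drho)] else
    [true, false].filterMap fun dthin2 =>
      let child : St := ⟨a, ne, dthin2, n2, th2⟩
      if valid child then some (some child, drho) else none

/-- All raw configurations with the four dimensions `≤ N`, filtered by `valid`. -/
def allValid (N : Nat) : List St :=
  let R := List.range (N + 1)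
  let bs := [false, true]
  bs.flatMap fun a => bs.flatMap fun e => bs.flatMap fun dthin =>
  R.flatMap fun n00 => R.flatMap fun n01 => R.flatMap fun n10 => R.flatMap fun n11 =>
  (List.range (n00 + 1)).flatMap fun t00 => (List.range (n01 + 1)).flatMap fun t01 =>
  (List.range (n10 + 1)).flatMap fun t10 => (List.range (n11 + 1)).filterMap fun t11 =>
    let n : Bool → Bool → Nat := fun Z d =>
      if Z then (if d then n11 else n10) else (if d then n01 else n00)
    let th : Bool → Bool → Nat := fun Z d =>
      if Z then (if d then t11 else t10) else (if d then t01 else t00)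
    let s : St := ⟨a, e, dthin, n, th⟩
    if valid s then some s else none

/-- Number of valid configurations (cross-check with g39 Appendix C.4: 2256 for `N = 4`, 10072 for `N = 5`). -/
def countValid (N : Nat) : Nat := (allValid N).length

/-- Lemma Φ / Lemma P check: every forced-type or R1-type step has `Δ(ρ_E+ρ_E′) ≤ 0`, and any
positive step is a free ii′ step of the anti-R1 type. -/
def checkPhi (N : Nat) : Bool :=
  (allValid N).all fun s =>
    match normalize s with
    | none => true
    | some (s2, cs, allowed) =>
      allowed.all fun t =>
        let r1 : Bool := (allowed.length == 1) || (t == vis (!s2.a) s2.e)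
        (steps s2 t cs).all fun p =>
          (decide (p.2 ≤ 0)) || ((!r1) && (cs == Case.ii) && (!s2.dthin))

/-- POLICY-FREE WINDOW 2: after any `Ψ`-neutral step (any admissible type), the normalised child is
in Case i′ and every admissible continuation drops. -/
def checkWindow2 (N : Nat) : Bool :=
  (allValid N).all fun s =>
    match normalize s with
    | none => true
    | some (s2, cs, allowed) =>
      allowed.all fun t =>
        (steps s2 t cs).all fun p =>
          (p.2 != 0) ||
          (match p.1 with
           | none => true
           | some c =>
             match normalize c with
             | none => true            -- no consistent continuation: unreachable configuration
             | some (c2, cs2, allowed2) =>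
               (cs2 == Case.i) &&
               allowed2.all fun t2 => (steps c2 t2 cs2).all fun q => decide (q.2 < 0))


/-- Number of full classes of space `(Z, d)`. -/
def full (n th : Bool → Bool → Nat) (Z d : Bool) : Nat := n Z d - th Z d

/-- LEMMA N of g42: a `Ψ`-neutral step is never an i′-step, and its passive side has exactly one space
cut, i.e. `ρ_Y` is unchanged (equivalently `ρ_X` is unchanged). -/
def checkNeutral (N : Nat) : Bool :=
  (allValid N).all fun s =>
    match normalize s with
    | none => true
    | some (s2, cs, allowed) =>
      allowed.all fun t =>
        (steps s2 t cs).all fun p =>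
          (p.2 != 0) ||
          (match p.1 with
           | none => true
           | some c => (!(cs == Case.i)) && (rho c s2.a == rho s2 s2.a) && (rho c (!s2.a) == rho s2 (!s2.a)))

/-- The case split of the proof of THEOREM W2 in g42 §3, with the intermediate assertions of each
sub-case: (β) HYP; (α-thin) direct / transfer; (α-full-R1) forced / free; (α-full-anti) (a) / (b).
Returns `true` iff every neutral non-leaf edge falls into one of the sub-cases AND satisfies that
sub-case's assertions. -/
def checkShape (N : Nat) : Bool :=
  (allValid N).all fun s =>
    match normalize s with
    | none => true
    | some (s2, cs, allowed) =>
      let a := s2.a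
      let y := !s2.a
      let e := s2.e
      let ne := !s2.e
      allowed.all fun t =>
        let r1 : Bool := (allowed.length == 1) || (t == vis y e)
        (steps s2 t cs).all fun p =>
          (p.2 != 0) ||
          (match p.1 with
           | none => true
           | some c =>
             let n2 := c.n
             let th2 := c.th
             match cs with
             | Case.i => false
             | Case.hyp =>
               -- (β): Y-companion zero at n; at m: Y class space = full line, X class space all thin,
               -- X companion keeps a full class, d_X(m) thin, no transfer, Case i′.
               (s2.n y ne == 0) && (n2 y ne == 1) && (th2 y ne == 0) && (th2 a ne == n2 a ne) &&
               decide (1 ≤ full n2 th2 a e) && c.dthin &&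
               (match normalize c with
                | some (c3, cs3, _) => (cs3 == Case.i) && (c3.a == a)
                | none => false)
             | Case.ii =>
               if s2.dthin then
                 -- (α-thin): forced type t(X,ε); Y-companion zero at n; d_X(m) spans an all-thin line;
                 -- Y^{ε̄}(m) a full line; #full X^ε preserved.
                 (t == vis a e) && (s2.n y ne == 0) && (n2 a ne == 1) && (th2 a ne == 1) &&
                 (n2 y ne == 1) && (th2 y ne == 0) && (full n2 th2 a e == full s2.n s2.th a e) &&
                 (match normalize c with
                  | none => false
                  | some (c3, cs3, _) =>
                    (cs3 == Case.i) &&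
                    (if c3.a == a then
                      -- direct: X^ε(n) had a full class
                      decide (1 ≤ full s2.n s2.th a e)
                     else
                      -- transfer: X all thin at n already, and 4.4 forces dim Y^ε(n) ≥ 3
                      (full s2.n s2.th a e == 0) && (s2.th a e == s2.n a e) &&
                      decide (3 ≤ s2.n y e) && decide (2 ≤ n2 y e)))
               else if r1 then
                 -- (α-full-R1): Y^{ε̄}(n) all thin; d_X(m) full; #full X^ε drops by one; direct i′;
                 -- Y^{ε̄}(m) all thin, non-zero, of type t(Y,ε̄) = t(X,ε);
                 -- dichotomy: #full X^ε(n) = 1 ⇒ forced type t(X,ε) at m; else Y^ε(m) keeps a thin class.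
                 (s2.th y ne == s2.n y ne) && (n2 a ne == 1) && (th2 a ne == 0) &&
                 (full n2 th2 a e + 1 == full s2.n s2.th a e) &&
                 (th2 y ne == n2 y ne) && decide (1 ≤ n2 y ne) && (vis y ne == vis a e) &&
                 (match normalize c with
                  | none => false
                  | some (c3, cs3, allowed3) =>
                    (cs3 == Case.i) && (c3.a == a) &&
                    (if full s2.n s2.th a e == 1 then
                       (th2 a e == n2 a e) && (allowed3 == [vis a e])
                     else
                       decide (2 ≤ s2.th y e) && decide (3 ≤ s2.n y e) &&
                       decide (2 ≤ n2 y e) && decide (1 ≤ th2 y e)))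
               else if s2.n y ne == 0 then
                 -- (α-full-anti-a): Y^ε(n) has a full class (cut), Y^{ε̄}(n) = 0; d_X(m) thin line,
                 -- X^ε(m) keeps a full class, Y^{ε̄}(m) full line, direct i′.
                 decide (1 ≤ full s2.n s2.th y e) && (n2 a ne == 1) && (th2 a ne == 1) &&
                 decide (1 ≤ full n2 th2 a e) && (n2 y ne == 1) && (th2 y ne == 0) &&
                 (match normalize c with
                  | some (c3, cs3, _) => (cs3 == Case.i) && (c3.a == a)
                  | none => false)
               else
                 -- (α-full-anti-b): Y^ε(n) all thin (uncut), Y^{ε̄}(n) ≠ 0 (cut); Y^ε(m) has dim ≥ 2;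
                 -- Case i′ at m for whichever system is active, the passive system having both spaces ≠ 0.
                 (s2.th y e == s2.n y e) && (n2 y e == s2.n y e + 1) && (n2 y ne + 1 == s2.n y ne) &&
                 decide (2 ≤ n2 y e) &&
                 (match normalize c with
                  | none => false
                  | some (c3, cs3, _) =>
                    (cs3 == Case.i) &&
                    (if c3.a == a then decide (1 ≤ n2 y e) && decide (1 ≤ n2 y ne)
                     else decide (1 ≤ n2 a e) && decide (1 ≤ n2 a ne))))

theorem countValid_le4 : countValid 4 = 2256 := by native_decide
theorem phiR1_le4 : checkPhi 4 = true := by native_decide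
theorem window2_le4 : checkWindow2 4 = true := by native_decide
theorem neutral_le4 : checkNeutral 4 = true := by native_decide
theorem shape_le4 : checkShape 4 = true := by native_decide
theorem countValid_le5 : countValid 5 = 10072 := by native_decide
theorem phiR1_le5 : checkPhi 5 = true := by native_decide
theorem window2_le5 : checkWindow2 5 = true := by native_decide
theorem neutral_le5 : checkNeutral 5 = true := by native_decide
theorem shape_le5 : checkShape 5 = true := by native_decide
theorem countValid_le6 : countValid 6 = 30048 := by native_decide
theorem phiR1_le6 : checkPhi 6 = true := by native_decide
theorem window2_le6 : checkWindow2 6 = true := by native_decide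
theorem neutral_le6 : checkNeutral 6 = true := by native_decide
theorem shape_le6 : checkShape 6 = true := by native_decide

end Summit.BirchSwinnertonDyer.BirchSwinnertonDyer.Cruxes.EllipticUnitValueSevenOfGZK.CuspidalDescent.Window
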